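import Summits.ResolutionOfSingularities.ResolutionOfSingularities.Theorems.MarkedTransferCampaignW13RFlatCanonicalPosSurfaceAllPTop
import HarnessLib

/-!
# [OURS · L1 W1.3] Surfaces, every characteristic — a SECOND uniform family of LOWER ORDER `p² − p + 1`:
# `g′_p = u^p + x^{p(p²−p+1)} + L·(L^p − x^{p²+1})^{p−1}`, `L = y − x` (part 1/2: arc and `u^p ∉ ℘_alg`) (seat res-L1-s13-pv-1, g3)

LADDER-RESOLUTION rung L (rescue), cell `res-hironaka`, RESCUE-SEED slot W1.3 (architecture bypass, reading R-flat), F7′ row 1.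
p514228 / p515380 refuted o2's content Prop `Campaign.CampaignW13RFlatCanonicalPos` (p483384) for SURFACES in every characteristic
with the family `ε_p = (x³L^{p−2})^p + L^{p−1}(L^p + x^{2p+1})^{p−1}` of order `p² − 1`. Kit j274681 (tag res; linear arc-solver over
`𝔽₃`, degree ≤ 24) then found `p = 3` heads of ORDER 7 < 8; the sparsest (`−(y−x)⁷ + 2x²y¹³ + x⁵y¹⁰ + x⁵y¹⁸ + 2x⁴y¹⁹`, arc `(s³, s³+s¹¹)`)
reads in `(x, L)`-coordinates as `(x⁴L)³ + L(L³ − x¹¹)² + (null-space terms)`, whence THIS family (`p = k + 2`):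

  `F′ := L^p − x^{p²+1}`,  `ε′_p := x^{p(p²−p+1)} + L·F′^{p−1}`,  `g′_p := u^p + ε′_p`,

of ORDER `p² − p + 1` (`= 3, 7, 21, 43` for `p = 2, 3, 5, 7`; at `p = 2` again g2's S): the pure power `x^{p(p²−p+1)}` is exactly
minus the `p`-power part of `L·F′^{p−1}` (the `k = p−1` term of the binomial expansion times the `−x` of `L = y − x`), so `ε′_p` is
`p`-power-free (part 2). THE ARC `γ(s) = (s^p, s^p + s^{p²+1}, −s^{p(p²−p+1)})` lies on `g′_p = 0` (cusp `L^p = x^{p²+1}`, `u = −x^{p²−p+1}`);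
along it the only non-vanishing Hasse derivative of order `< p` is `D_x^{(p−1)}g′_p = L·(x^{p²})^{p−1} + …` of `s`-order EXACTLY
`p²(p²−p+1) + 1 = τ + 1` (slack `0`), `τ = ord u^p∘γ`; with `θ = s^{τ+1}` the scaled-Taylor certificate of p512821 applies:
`C(θ^p) ∣ g′_p(γ + θ·v)` by the ring identity `surfLow_ring_dvd` (any commutative ring of characteristic `p`), hence
**`u^p ∉ ℘_alg(((g′_p), p), 1)`** for every prime `p` and every field of characteristic `p` (`surfLow_tail_pow_not_mem`; stalk form).
Exponent bookkeeping in `k`: `p²+1 = k²+4k+5`, `p²−p+1 = k²+3k+3`, `p(p²−p+1) = k³+5k²+9k+6`, `τ+1 = k⁴+7k³+19k²+24k+13`.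
Computed evidence on minimality (not a theorem): kit j274638 / j274681 found NO `p = 3` witness of order `≤ 6` up to degree 18 / (pending
j274816, j274817 at degree 24). Caveat of record: nothing here bears on L-G4 / (127) (`KangarooShadeIncrease`).

HONEST FRAMING. OURS statements about the OURS bypass objects (bound algebraic `℘`, row 003 U17_2; candidate U17_4 not used);
nothing here is a statement of H. Hironaka's manuscript [Hironaka2017] (2017-03-23, lit key `paper:url-3343fd9e678b`); no claim
about resolution of singularities in positive characteristic; AI bookkeeping weaker than expert review. All decls `[folklore]`,
sorry-free.
-/

noncomputable section

set_option linter.dupNamespace false -- mandated namespace of this single-conjunct summit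

namespace Summit.ResolutionOfSingularities.ResolutionOfSingularities.Theorems.Campaign

open MvPolynomial
open Literature.AlgebraicGeometry.Resolution
open Literature.AlgebraicGeometry.Hironaka2017
open Literature.AlgebraicGeometry.Hironaka2017.S09LLUED (LLChainData)

namespace W13

/-! ## §1 Ring-level scaled-Taylor divisibility for the low-order family -/

section TaylorRingLow

variable {R : Type*} [CommRing R] (k : ℕ) [hp : Fact (k + 2).Prime] [CharP R (k + 2)]

/-- **Scaled-Taylor divisibility, ring level, low-order family.** In a commutative ring of characteristic `p = k+2`, with
`λ^p = ξ^{p²+1}` (the cusp), `D^{p−1}·λ·ξ^{p²(p−1)} ∈ D^p·R` (the `θ`-bookkeeping) and `uu = −ξ^{p²−p+1}`: `D^p` divides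
`(uu + Dv₂)^p + (ξ + Dv₀)^{p(p²−p+1)} + (λ + Dw)·((λ + Dw)^p − (ξ + Dv₀)^{p²+1})^{p−1}`. [folklore] -/
theorem surfLow_ring_dvd (ξ lam D w v₀ v₂ uu r₀ : R)
    (hF0 : lam ^ (k + 2) = ξ ^ (k ^ 2 + 4 * k + 4 + 1)) (hu : uu = -(ξ ^ (k ^ 2 + 3 * k + 3)))
    (hD : D ^ (k + 1) * (lam * ξ ^ ((k ^ 2 + 4 * k + 4) * (k + 1))) = D ^ (k + 2) * r₀) :
    D ^ (k + 2) ∣ (uu + D * v₂) ^ (k + 2) + (ξ + D * v₀) ^ ((k ^ 2 + 3 * k + 3) * (k + 2)) +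
      (lam + D * w) * ((lam + D * w) ^ (k + 2) - (ξ + D * v₀) ^ (k ^ 2 + 4 * k + 4 + 1)) ^ (k + 1) := by
  have hchar : ((k + 2 : ℕ) : R) = 0 := CharP.cast_eq_zero R (k + 2)
  -- (1) the `u`-part
  have h1 : (uu + D * v₂) ^ (k + 2) = uu ^ (k + 2) + D ^ (k + 2) * v₂ ^ (k + 2) := by
    rw [add_pow_char uu (D * v₂) (k + 2), mul_pow]
  -- (2) the pure `x`-power
  obtain ⟨m₁, hm₁⟩ : ∃ m₁, (ξ + D * v₀) ^ (k ^ 2 + 3 * k + 3) = ξ ^ (k ^ 2 + 3 * k + 3) + D * m₁ := by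
    obtain ⟨c, hc⟩ := (Dvd.intro v₀ (by ring) : D ∣ (ξ + D * v₀) - ξ).trans (sub_dvd_pow_sub_pow _ _ (k ^ 2 + 3 * k + 3))
    exact ⟨c, by rw [← hc]; ring⟩
  have h2 : (ξ + D * v₀) ^ ((k ^ 2 + 3 * k + 3) * (k + 2)) =
      (ξ ^ (k ^ 2 + 3 * k + 3)) ^ (k + 2) + D ^ (k + 2) * m₁ ^ (k + 2) := by
    rw [pow_mul, hm₁, add_pow_char _ (D * m₁) (k + 2), mul_pow]
  -- (3) the arc lies on the hypersurface
  have h3 : uu ^ (k + 2) + (ξ ^ (k ^ 2 + 3 * k + 3)) ^ (k + 2) = 0 := by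
    rw [hu, neg_pow, neg_one_pow_char R (k + 2)]
    ring
  -- (4) `F′(γ + Dv) = D·(−ξ^{p²}v₀ + D·A₁)`
  obtain ⟨r, hr⟩ := exists_add_pow_succ_eq ξ (D * v₀) (k ^ 2 + 4 * k + 4)
  have hcast : ((k ^ 2 + 4 * k + 4 + 1 : ℕ) : R) = 1 := by
    have e : ((k ^ 2 + 4 * k + 4 + 1 : ℕ) : R) = ((k + 2 : ℕ) : R) ^ 2 + 1 := by push_cast; ring
    rw [e, hchar]; ring
  have h4 : (lam + D * w) ^ (k + 2) - (ξ + D * v₀) ^ (k ^ 2 + 4 * k + 4 + 1) =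
      D * (-(ξ ^ (k ^ 2 + 4 * k + 4) * v₀) + D * (D ^ k * w ^ (k + 2) - v₀ ^ 2 * r)) := by
    rw [add_pow_char lam (D * w) (k + 2), hr, hcast]
    linear_combination hF0
  -- (5) first-order expansion of the `(p−1)`-st power
  obtain ⟨r₂, hr₂⟩ : ∃ r₂, (-(ξ ^ (k ^ 2 + 4 * k + 4) * v₀) + D * (D ^ k * w ^ (k + 2) - v₀ ^ 2 * r)) ^ (k + 1) =
      (-(ξ ^ (k ^ 2 + 4 * k + 4) * v₀)) ^ (k + 1) + D * r₂ := by
    obtain ⟨c, hc⟩ := (Dvd.intro (D ^ k * w ^ (k + 2) - v₀ ^ 2 * r) (by ring) :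
      D ∣ (-(ξ ^ (k ^ 2 + 4 * k + 4) * v₀) + D * (D ^ k * w ^ (k + 2) - v₀ ^ 2 * r)) - -(ξ ^ (k ^ 2 + 4 * k + 4) * v₀)).trans
        (sub_dvd_pow_sub_pow _ _ (k + 1))
    exact ⟨c, by rw [← hc]; ring⟩
  have hA : (-(ξ ^ (k ^ 2 + 4 * k + 4) * v₀)) ^ (k + 1) = (-1) ^ (k + 1) * (ξ ^ ((k ^ 2 + 4 * k + 4) * (k + 1)) * v₀ ^ (k + 1)) := by
    rw [neg_pow, mul_pow, ← pow_mul]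
  have h4' : ((lam + D * w) ^ (k + 2) - (ξ + D * v₀) ^ (k ^ 2 + 4 * k + 4 + 1)) ^ (k + 1) =
      D ^ (k + 1) * ((-1) ^ (k + 1) * (ξ ^ ((k ^ 2 + 4 * k + 4) * (k + 1)) * v₀ ^ (k + 1)) + D * r₂) := by
    rw [h4, mul_pow, hr₂, hA]
  -- (6) assemble
  refine ⟨v₂ ^ (k + 2) + m₁ ^ (k + 2) + (lam * r₂ +
      w * ((-1) ^ (k + 1) * (ξ ^ ((k ^ 2 + 4 * k + 4) * (k + 1)) * v₀ ^ (k + 1)) + D * r₂)) +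
        (-1) ^ (k + 1) * v₀ ^ (k + 1) * r₀, ?_⟩
  rw [h1, h2, h4']
  linear_combination h3 + (-1) ^ (k + 1) * v₀ ^ (k + 1) * hD

end TaylorRingLow

/-! ## §2 The head `g′_p`, the arc `γ(s) = (s^p, s^p + s^{p²+1}, −s^{p(p²−p+1)})`, `θ = s^{p²(p²−p+1)+1}`, and
## `u^p ∉ ℘_alg(((g′_p), p), 1)` — exponent parameter `k`, `p = k + 2` -/

section ArcNumericsLow

/-- The exponent bookkeeping behind `θ`: `θ^{p−1}·λ·ξ^{p²(p−1)} = θ^p` EXACTLY (slack `0`) for `ξ = s^p`, `λ = s^{p²+1}`.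
[folklore] -/
theorem surfLow_theta (K : Type) [Field K] (k : ℕ) :
    ((Polynomial.X : Polynomial K) ^ (k ^ 4 + 7 * k ^ 3 + 19 * k ^ 2 + 24 * k + 12 + 1)) ^ (k + 1) *
        (Polynomial.X ^ (k ^ 2 + 4 * k + 4 + 1) * (Polynomial.X ^ (k + 2)) ^ ((k ^ 2 + 4 * k + 4) * (k + 1))) =
      (Polynomial.X ^ (k ^ 4 + 7 * k ^ 3 + 19 * k ^ 2 + 24 * k + 12 + 1)) ^ (k + 2) * 1 := by
  ring

/-- The tail along the arc: `u(s)^p = (−1)^p·s^{p²(p²−p+1)}` for `u = −s^{p(p²−p+1)}`. [folklore] -/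
theorem surfLow_u_pow (K : Type) [Field K] (k : ℕ) :
    (-((Polynomial.X : Polynomial K) ^ (k + 2)) ^ (k ^ 2 + 3 * k + 3)) ^ (k + 2) =
      Polynomial.C ((-1 : K) ^ (k + 2)) * Polynomial.X ^ (k ^ 4 + 7 * k ^ 3 + 19 * k ^ 2 + 24 * k + 12) := by
  have hC : Polynomial.C ((-1 : K) ^ (k + 2)) = (-1 : Polynomial K) ^ (k + 2) := by simp
  rw [hC, neg_pow, ← pow_mul, ← pow_mul]
  ring

/-- `θ = s^{N+1}` does not divide `u(s)^p = ±s^N`. [folklore] -/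
theorem surfLow_theta_not_dvd_u_pow (K : Type) [Field K] (k : ℕ) :
    ¬ (Polynomial.X : Polynomial K) ^ (k ^ 4 + 7 * k ^ 3 + 19 * k ^ 2 + 24 * k + 12 + 1) ∣
      (-((Polynomial.X : Polynomial K) ^ (k + 2)) ^ (k ^ 2 + 3 * k + 3)) ^ (k + 2) := by
  rw [surfLow_u_pow, Polynomial.X_pow_dvd_iff]
  intro h
  have h1 := h (k ^ 4 + 7 * k ^ 3 + 19 * k ^ 2 + 24 * k + 12) (Nat.lt_succ_self _)
  rw [Polynomial.coeff_C_mul_X_pow, if_pos rfl] at h1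
  exact pow_ne_zero _ (neg_ne_zero.mpr one_ne_zero) h1

end ArcNumericsLow

section HeadLow

variable (K : Type) [Field K] (k : ℕ) [hp : Fact (k + 2).Prime] [CharP K (k + 2)]

/-- **The scaled Taylor certificate for `g′_p`**: `C(θ^p) ∣ g′_p(γ(s) + θ·v)` in `K[s][v₀,v₁,v₂]` — the ring-level
`surfLow_ring_dvd` at `ξ = s^p`, `λ = s^{p²+1}`, `D = θ`, `w = v₁ − v₀`. [folklore] -/
theorem surfLow_scaled_taylor_dvd :
    (MvPolynomial.C (((Polynomial.X : Polynomial K) ^ (k ^ 4 + 7 * k ^ 3 + 19 * k ^ 2 + 24 * k + 12 + 1)) ^ (k + 2)) :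
        MvPolynomial (Fin 3) (Polynomial K)) ∣
      MvPolynomial.aeval (R := K)
        (fun i => (MvPolynomial.C ((![Polynomial.X ^ (k + 2), Polynomial.X ^ (k + 2) + Polynomial.X ^ (k ^ 2 + 4 * k + 4 + 1),
            -((Polynomial.X ^ (k + 2)) ^ (k ^ 2 + 3 * k + 3))] : Fin 3 → Polynomial K) i) :
            MvPolynomial (Fin 3) (Polynomial K)) +
          MvPolynomial.C (Polynomial.X ^ (k ^ 4 + 7 * k ^ 3 + 19 * k ^ 2 + 24 * k + 12 + 1)) * X i)
        (X 2 ^ (k + 2) + (X 0 ^ ((k ^ 2 + 3 * k + 3) * (k + 2)) +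
          (X 1 - X 0) * ((X 1 - X 0) ^ (k + 2) - X 0 ^ (k ^ 2 + 4 * k + 4 + 1)) ^ (k + 1)) : MvPolynomial (Fin 3) K) := by
  have haeval : MvPolynomial.aeval (R := K)
        (fun i => (MvPolynomial.C ((![Polynomial.X ^ (k + 2), Polynomial.X ^ (k + 2) + Polynomial.X ^ (k ^ 2 + 4 * k + 4 + 1),
            -((Polynomial.X ^ (k + 2)) ^ (k ^ 2 + 3 * k + 3))] : Fin 3 → Polynomial K) i) :
            MvPolynomial (Fin 3) (Polynomial K)) +
          MvPolynomial.C (Polynomial.X ^ (k ^ 4 + 7 * k ^ 3 + 19 * k ^ 2 + 24 * k + 12 + 1)) * X i)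
        (X 2 ^ (k + 2) + (X 0 ^ ((k ^ 2 + 3 * k + 3) * (k + 2)) +
          (X 1 - X 0) * ((X 1 - X 0) ^ (k + 2) - X 0 ^ (k ^ 2 + 4 * k + 4 + 1)) ^ (k + 1)) : MvPolynomial (Fin 3) K) =
      (MvPolynomial.C (-(((Polynomial.X : Polynomial K) ^ (k + 2)) ^ (k ^ 2 + 3 * k + 3))) +
          MvPolynomial.C (Polynomial.X ^ (k ^ 4 + 7 * k ^ 3 + 19 * k ^ 2 + 24 * k + 12 + 1)) * X 2) ^ (k + 2) +
        (MvPolynomial.C (Polynomial.X ^ (k + 2)) +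
            MvPolynomial.C (Polynomial.X ^ (k ^ 4 + 7 * k ^ 3 + 19 * k ^ 2 + 24 * k + 12 + 1)) * X 0) ^
          ((k ^ 2 + 3 * k + 3) * (k + 2)) +
        (MvPolynomial.C ((Polynomial.X : Polynomial K) ^ (k ^ 2 + 4 * k + 4 + 1)) +
            MvPolynomial.C (Polynomial.X ^ (k ^ 4 + 7 * k ^ 3 + 19 * k ^ 2 + 24 * k + 12 + 1)) * (X 1 - X 0)) *
          ((MvPolynomial.C ((Polynomial.X : Polynomial K) ^ (k ^ 2 + 4 * k + 4 + 1)) +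
              MvPolynomial.C (Polynomial.X ^ (k ^ 4 + 7 * k ^ 3 + 19 * k ^ 2 + 24 * k + 12 + 1)) * (X 1 - X 0)) ^ (k + 2) -
            (MvPolynomial.C (Polynomial.X ^ (k + 2)) +
              MvPolynomial.C (Polynomial.X ^ (k ^ 4 + 7 * k ^ 3 + 19 * k ^ 2 + 24 * k + 12 + 1)) * X 0) ^
                (k ^ 2 + 4 * k + 4 + 1)) ^ (k + 1) := by
    simp only [map_add, map_sub, map_neg, map_mul, map_pow, MvPolynomial.aeval_X, Matrix.cons_val_zero,
      Matrix.cons_val_one, Matrix.cons_val_two, Matrix.tail_cons, Matrix.head_cons]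
    ring
  have hF0 : (MvPolynomial.C ((Polynomial.X : Polynomial K) ^ (k ^ 2 + 4 * k + 4 + 1)) : MvPolynomial (Fin 3) (Polynomial K)) ^
        (k + 2) = MvPolynomial.C (Polynomial.X ^ (k + 2)) ^ (k ^ 2 + 4 * k + 4 + 1) := by
    rw [← map_pow, ← map_pow, ← pow_mul, ← pow_mul, mul_comm]
  have hD : (MvPolynomial.C (Polynomial.X ^ (k ^ 4 + 7 * k ^ 3 + 19 * k ^ 2 + 24 * k + 12 + 1)) :
        MvPolynomial (Fin 3) (Polynomial K)) ^ (k + 1) *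
        (MvPolynomial.C ((Polynomial.X : Polynomial K) ^ (k ^ 2 + 4 * k + 4 + 1)) *
          MvPolynomial.C (Polynomial.X ^ (k + 2)) ^ ((k ^ 2 + 4 * k + 4) * (k + 1))) =
      MvPolynomial.C (Polynomial.X ^ (k ^ 4 + 7 * k ^ 3 + 19 * k ^ 2 + 24 * k + 12 + 1)) ^ (k + 2) * MvPolynomial.C 1 := by
    rw [← map_pow, ← map_pow, ← map_mul, ← map_mul, ← map_pow, ← map_mul, surfLow_theta]
  rw [haeval, map_pow]
  exact surfLow_ring_dvd k _ _ _ (X 1 - X 0) (X 0) (X 2) _ _ hF0 (by simp only [map_neg, map_pow]) hD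

/-- **`u^p ∉ ℘_alg(((g′_p), p), 1)`** for every prime `p = k+2` and every field `K` of characteristic `p` (bound algebraic
`℘`, row 003 U17_2), by the scaled-Taylor arc criterion along `γ(s) = (s^p, s^p + s^{p²+1}, −s^{p(p²−p+1)})`. [folklore] -/
theorem surfLow_tail_pow_not_mem :
    (X 2 : MvPolynomial (Fin 3) K) ^ (k + 2) ∉
      Campaign.pAlgPiece K (Ideal.span {(X 2 ^ (k + 2) + (X 0 ^ ((k ^ 2 + 3 * k + 3) * (k + 2)) +
        (X 1 - X 0) * ((X 1 - X 0) ^ (k + 2) - X 0 ^ (k ^ 2 + 4 * k + 4 + 1)) ^ (k + 1)) : MvPolynomial (Fin 3) K)})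
        (k + 2) 1 := by
  classical
  refine not_mem_pAlgPiece_one_of_scaled_taylor K
    (![Polynomial.X ^ (k + 2), Polynomial.X ^ (k + 2) + Polynomial.X ^ (k ^ 2 + 4 * k + 4 + 1),
      -((Polynomial.X ^ (k + 2)) ^ (k ^ 2 + 3 * k + 3))] : Fin 3 → Polynomial K)
    (θ := (Polynomial.X : Polynomial K) ^ (k ^ 4 + 7 * k ^ 3 + 19 * k ^ 2 + 24 * k + 12 + 1))
    (pow_ne_zero _ Polynomial.X_ne_zero) _ (k + 2) (surfLow_scaled_taylor_dvd K k) ?_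
  simp only [map_pow, MvPolynomial.aeval_X, Matrix.cons_val_two, Matrix.tail_cons, Matrix.head_cons]
  exact surfLow_theta_not_dvd_u_pow K k

/-- **Stalk-level form**: `s·u^p ∉ ℘_alg(((g′_p),p),1)` whenever `s(0) ≠ 0`. [folklore] -/
theorem surfLow_mul_tail_pow_not_mem (s : MvPolynomial (Fin 3) K) (hs : coeff 0 s ≠ 0) :
    s * X 2 ^ (k + 2) ∉
      Campaign.pAlgPiece K (Ideal.span {(X 2 ^ (k + 2) + (X 0 ^ ((k ^ 2 + 3 * k + 3) * (k + 2)) +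
        (X 1 - X 0) * ((X 1 - X 0) ^ (k + 2) - X 0 ^ (k ^ 2 + 4 * k + 4 + 1)) ^ (k + 1)) : MvPolynomial (Fin 3) K)})
        (k + 2) 1 := by
  classical
  have hf : ∀ i, ((![Polynomial.X ^ (k + 2), Polynomial.X ^ (k + 2) + Polynomial.X ^ (k ^ 2 + 4 * k + 4 + 1),
      -((Polynomial.X ^ (k + 2)) ^ (k ^ 2 + 3 * k + 3))] : Fin 3 → Polynomial K) i).coeff 0 = 0 := by
    intro i
    fin_cases i <;> simp [Polynomial.coeff_zero_eq_eval_zero]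
  refine not_mem_pAlgPiece_one_of_scaled_taylor K
    (![Polynomial.X ^ (k + 2), Polynomial.X ^ (k + 2) + Polynomial.X ^ (k ^ 2 + 4 * k + 4 + 1),
      -((Polynomial.X ^ (k + 2)) ^ (k ^ 2 + 3 * k + 3))] : Fin 3 → Polynomial K)
    (θ := (Polynomial.X : Polynomial K) ^ (k ^ 4 + 7 * k ^ 3 + 19 * k ^ 2 + 24 * k + 12 + 1))
    (pow_ne_zero _ Polynomial.X_ne_zero) _ (k + 2) (surfLow_scaled_taylor_dvd K k) ?_
  simp only [map_mul, map_pow, MvPolynomial.aeval_X, Matrix.cons_val_two, Matrix.tail_cons, Matrix.head_cons]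
  rw [surfLow_u_pow, ← mul_assoc, Polynomial.X_pow_dvd_iff]
  intro h
  have h1 := h (k ^ 4 + 7 * k ^ 3 + 19 * k ^ 2 + 24 * k + 12) (Nat.lt_succ_self _)
  rw [Polynomial.coeff_mul_X_pow', if_pos le_rfl, Nat.sub_self, Polynomial.coeff_mul_C] at h1
  have h0 := coeff_zero_aeval_of_coeff_zero K _ hf s
  rcases mul_eq_zero.mp h1 with h2 | h2
  · rw [h2] at h0
    exact hs h0.symm
  · exact pow_ne_zero _ (neg_ne_zero.mpr one_ne_zero) h2

end HeadLow

end W13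

end Summit.ResolutionOfSingularities.ResolutionOfSingularities.Theorems.Campaign

end
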